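import Summits.BirchSwinnertonDyer.BirchSwinnertonDyer.Theorems.UniversalToricDescentSigmaCoinvariants
import Summits.BirchSwinnertonDyer.BirchSwinnertonDyer.Theorems.UniversalToricDescentSigmaLocalImageEngine
import Summits.BirchSwinnertonDyer.BirchSwinnertonDyer.Theorems.UniversalToricDescentSigmaLocalStabilizer
import HarnessLib

/-!
# Route UniversalToricDescent — `loc_v` is ONTO over `K_∞` (Greenberg–Vatsal Cor. (2.3) for Castella's
# anticyclotomic Selmer groups): every element of `⊕_{w∣v} H¹(K_{∞,w}, E[p^∞])` is the signature of a
# class of `Sel_𝔭^{Σ∪{v}}(K_∞, E[p^∞])`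

Lead prover bsd-wall-utd-p1 g8 (`--supports stmt-BirchSwinnertonDyer-20399`; memo ALG-HALF-21845-STATUS
§3 (d), the ONE algebraic input left in child 21845 after g7). For a totally complex number field `K`, a
`ℤ_p`-extension `κ` (`H = ker κ`, topological generator `γ`), an elliptic curve `W/K`, the strict place
`𝔭 ∋ p` and `𝔮 ≠ 𝔭` above `p`, a set `Σ` of places and a place `v ∤ p` FINITELY DECOMPOSED in `K_∞`
(`D_v ⊄ H`), the local target `⊕_{w ∣ v} H¹(K_{∞,w}, E[p^∞])` is modelled CANONICALLY as the group of
functions `F : Γ_K → H¹(H ∩ D_v, E[p^∞])` (`H ∩ D_v = kerD κ v ≤ D_v`, `X11b.CoinvariantsLocal`) that are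
right-`H`-invariant and left-`D_v`-equivariant (`F(d σ h) = conj_d F(σ)`); the signature of
`s ∈ H¹(K_∞, E[p^∞])` is `σ ↦ res_{H ∩ D_v}(conj_σ s)` (its localisations at all places above `v`).

* `exists_decomp_mul_pow_lt_mul_mem_ker` — `Γ_K = D_v · γ^{<p^c} · H` (`κ(D_v) = p^c ℤ_p`).
* **`exists_mem_selmerAc_insert_forall_resKerD_conjH1_eq`** — SURJECTIVITY under the hypotheses of the
  tree's (L10) (`UniversalToricDescentSigmaCoinvariants`: Poitou–Tate fact, Milne I 2.8 at the completions,
  (iv) `E[p^∞]^{Γ_{K_𝔭}} = 0`, `Sel_𝔮(K, E[p^∞])` finite, `H²(K, E[p^∞]) = 0`). Proof = the corank-free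
  engine `surjective_of_comm_of_surjective_of_ker_le` (p581802) with `φ = conj_γ − 1` on `Sel^{Σ∪{v}}`
  (ONTO: (L10)^{Σ∪{v}}, p581291) and `ψ = R_γ − 1` on the target (`R_γ F(σ) = F(σγ)`): (b) `ker ψ ⊆ im` — a
  `γ`-periodic `F` is constant `= f` on `γ^ℕ`; `f` is fixed by `κ_{D_v}⁻¹(p^c ℕ)` and by
  `κ_{D_v}⁻¹(p^t ℤ_p)` ((A2)_v, p584297), hence by all of `D_v`; so `f = res z`, `z ∈ H¹(D_v, E[p^∞])`
  (procyclic descent for `κ|_{D_v}`, `ProcyclicDescentRescaled`); Poitou–Tate surgery at the base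
  (`levelLiftingP_of_finite`: a global class with `loc_v = z`, `loc_𝔭 = 0`, locally zero off `v`)
  restricts to an `s ∈ Sel^{Σ∪{v}}` with signature `F`; (c) `ψ` locally nilpotent — `R_γ^{p^{c+t}} F = F`
  ((A2)_v at the finitely many values `F(γ^i)`, `i < p^c`) and `p^k F = 0`, so
  `(R_γ − 1)^{k p^{c+t}} F = 0` (`IwasawaDual.pow_mul_prime_pow_apply_eq_zero`).

HONEST STATUS: helper theorem, CONDITIONAL on the cited Poitou–Tate fact like every (L10)-descendant;
kernel, route instance and the count `Sel^{Σ∪{v}}/Sel^Σ ≅ H¹(K_{∞,w₀}, E[p^∞])^{p^c}` are the companion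
file; the analytic half and 20395 are untouched. THEOREMS ONLY; no definition, no named fact, no `sorry`.
BSD is not advanced by this file.
References: [GreenbergVatsal2000] §2 Prop. (2.1), Cor. (2.3), Prop. (2.4) (pp. 23–25);
[JetchevSkinnerWan2017] Prop. 3.3.2, Lemma 3.3.3 (arXiv:1512.06894 pp. 11–12); [GreenbergLNM1716] §1, §3;
[Castella2018] Def. 2.2 (arXiv:1704.06608 p. 5); [MilneADT2006] I 4.10.
-/

set_option autoImplicit false
-- `…BirchSwinnertonDyer.BirchSwinnertonDyer.Theorems…` is the problem's mandated namespace (D-0017).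
set_option linter.dupNamespace false

noncomputable section

open scoped Classical

namespace Summit.BirchSwinnertonDyer.BirchSwinnertonDyer.Theorems.UniversalToricDescentSigmaLocalImage

open CategoryTheory Function Field NumberField IsDedekindDomain WeierstrassCurve
open Literature.NumberTheory.GaloisRepresentations Literature.NumberTheory.EllipticCurves
  Literature.NumberTheory.EllipticCurves.GreenbergSelmer Literature.NumberTheory.GaloisCohomology
  Literature.NumberTheory.EllipticCurves.Rank1Residual
  Summit.BirchSwinnertonDyer.Rank1Residual Summit.BirchSwinnertonDyer.Rank1Residual.X11b
  Summit.BirchSwinnertonDyer.Rank1Residual.X11b.Coinv Summit.BirchSwinnertonDyer.Rank1Residual.X11b.LocBridge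
  Summit.BirchSwinnertonDyer.Rank1Residual.X11b.AcSelmer Summit.BirchSwinnertonDyer.Rank1Residual.X11b.H2Support
  Summit.BirchSwinnertonDyer.Rank1Residual.X11b.Levels
  Summit.BirchSwinnertonDyer.BirchSwinnertonDyer.Theorems.UniversalToricDescentSigmaCoinvariants
  Summit.BirchSwinnertonDyer.BirchSwinnertonDyer.Theorems.UniversalToricDescentSigmaLocalStabilizer
open Summit.BirchSwinnertonDyer.Rank1Residual.X11b.ProcyclicDescent (kerK)

variable {K : Type} [Field K] [NumberField K] (W : WeierstrassCurve K) [W.IsElliptic] (p : ℕ)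
  [Fact p.Prime] (κ : ZpExtension K p)

/-! ### Surjectivity of the signature map (GV Cor. (2.3) over `K_∞`) -/

variable {p} in
/-- `Γ_K = D_v · γ^{<p^c} · ker κ`: the decomposition of `exists_decomp_mul_pow_mul_mem_ker` with the
exponent reduced below `p^c` (`PadicInt.appr_lt`). [cite: Washington1997, §13.1] -/
theorem exists_decomp_mul_pow_lt_mul_mem_ker {γ : absoluteGaloisGroup K} (hγ : κ.IsTopGenerator γ)
    (v : HeightOneSpectrum (𝓞 K)) {c : ℕ}
    (hc : ∀ z : ℤ_[p], ∃ d : decomp (K := K) v,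
      (κ (d : absoluteGaloisGroup K)).toAdd = (p : ℤ_[p]) ^ c * z)
    (σ : absoluteGaloisGroup K) :
    ∃ (d : decomp (K := K) v) (n : ℕ) (h : absoluteGaloisGroup K), n < p ^ c ∧ h ∈ κ.kerSubgroup ∧
      σ = d * γ ^ n * h := by
  set x : ℤ_[p] := (κ σ).toAdd with hx
  obtain ⟨z, hz⟩ := Ideal.mem_span_singleton.mp (PadicInt.appr_spec c x)
  obtain ⟨d, hd⟩ := hc z
  refine ⟨d, x.appr c, ((d : absoluteGaloisGroup K) * γ ^ x.appr c)⁻¹ * σ, PadicInt.appr_lt x c, ?_, ?_⟩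
  · rw [ZpExtension.mem_kerSubgroup, map_mul, map_inv, map_mul, map_pow,
      show κ γ = Multiplicative.ofAdd 1 from hγ, ← ofAdd_nsmul]
    apply Multiplicative.toAdd.injective
    rw [toAdd_mul, toAdd_inv, toAdd_mul, toAdd_ofAdd, toAdd_one, hd, nsmul_eq_mul, mul_one, ← hx]
    linear_combination hz
  · rw [mul_inv_cancel_left]

set_option maxHeartbeats 400000 in
/-- **`loc_v` is onto over `K_∞` (Greenberg–Vatsal Cor. (2.3)) for `Sel_𝔭^{Σ∪{v}}(K_∞, E[p^∞])`.**
Hypotheses as in the tree's (L10) `surjective_conjSelmerAc_sub_one_of_subsingleton` (`K` totally complex;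
Poitou–Tate fact; Milne I 2.8 at the completions; `𝔭 ≠ 𝔮` above `p`; (iv) at `𝔭`; `Sel_𝔮(K, E[p^∞])`
finite; `H²(K, E[p^∞]) = 0`; `γ` a topological generator), a set `Σ` and a place `v ∤ p` finitely
decomposed in `K_∞`. Then every `F : Γ_K → H¹(H ∩ D_v, E[p^∞])` that is right-`ker κ`-invariant and
left-`D_v`-equivariant (`F(d σ) = conj_d F(σ)`) — i.e. every element of `⊕_{w∣v} H¹(K_{∞,w}, E[p^∞])` — is
the signature `σ ↦ res_{H∩D_v}(conj_σ s)` of some `s ∈ Sel_𝔭^{Σ∪{v}}(K_∞, E[p^∞])`. Engine (p581802) with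
`φ = conj_γ − 1` ONTO (L10)^{Σ∪{v}}, `ψ = R_γ − 1`; `ker ψ ⊆ im` by procyclic descent on `D_v` + Poitou–Tate
surgery at the base; `ψ` locally nilpotent by (A2)_v, (P)_v. [cite: GreenbergVatsal2000, §2 Cor. (2.3) and Prop. (2.1) (pp. 23–25)]
[cite: JetchevSkinnerWan2017, Prop. 3.3.2 and Lemma 3.3.3 (arXiv:1512.06894 pp. 11–12)] -/
theorem exists_mem_selmerAc_insert_forall_resKerD_conjH1_eq [IsTotallyComplex K]
    (hPT : poitouTate_selmerStructure_duality K)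
    (hEP : ∀ v : HeightOneSpectrum (𝓞 K), localEulerPoincareCharacteristic (v.adicCompletion K))
    {𝔭 𝔮 : HeightOneSpectrum (𝓞 K)} (h𝔭 : ((p : ℕ) : 𝓞 K) ∈ 𝔭.asIdeal)
    (h𝔮 : ((p : ℕ) : 𝓞 K) ∈ 𝔮.asIdeal) (hne : 𝔮 ≠ 𝔭)
    (hΓ𝔭 : ∀ Q : W.geomPrimaryTorsion p,
      (∀ σ : absoluteGaloisGroup (𝔭.adicCompletion K),
        GaloisRep.restrictField (𝔭.adicCompletion K) (primaryGaloisModule W p) σ Q = Q) → Q = 0)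
    (hfin : Finite (selmerAcBase W p 𝔮 ∅))
    (h2 : Subsingleton (galoisCohomology (primaryGaloisModule W p) 2))
    {γ : absoluteGaloisGroup K} (hγ : κ.IsTopGenerator γ) (S : Set (HeightOneSpectrum (𝓞 K)))
    {v : HeightOneSpectrum (𝓞 K)} (hpv : ((p : ℕ) : 𝓞 K) ∉ v.asIdeal)
    (hv : ¬ (decomp v ≤ κ.kerSubgroup))
    (F : absoluteGaloisGroup K → subgroupH1 (kerD κ v) (W.geomPrimaryTorsion p))
    (hFH : ∀ (σ h : absoluteGaloisGroup K), h ∈ κ.kerSubgroup → F (σ * h) = F σ)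
    (hFD : ∀ (d : decomp (K := K) v) (σ : absoluteGaloisGroup K),
      F ((d : absoluteGaloisGroup K) * σ) = conjH1 (kerD κ v) (W.geomPrimaryTorsion p) d (F σ)) :
    ∃ s ∈ selmerAc W p κ 𝔭 (insert v S), ∀ σ : absoluteGaloisGroup K,
      resKerD κ (W.geomPrimaryTorsion p) v (W.conjH1 p κ.kerSubgroup σ s) = F σ := by
  have hpr : p.Prime := Fact.out
  haveI : CompactSpace (absoluteGaloisGroup K) := absoluteGaloisGroup_compactSpace K
  haveI : CompactSpace (decomp (K := K) v) :=
    isCompact_iff_compactSpace.mp (Coinv.isClosed_decomp v).isCompact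
  have hγ' : κ γ = Multiplicative.ofAdd 1 := hγ
  -- notation
  set H := κ.kerSubgroup with hH
  have hM : ∀ m : W.geomPrimaryTorsion p, IsOpen {σ : absoluteGaloisGroup K | σ • m = m} :=
    isOpen_stabilizer_geomPrimaryTorsion W p
  have htor : IsPrimaryTorsion p (W.geomPrimaryTorsion p) := isPrimaryTorsion_geomPrimaryTorsion W p
  have hA : ∀ a : W.geomPrimaryTorsion p, IsOpen {d : decomp (K := K) v | d • a = a} := fun a ↦
    (hM a).preimage continuous_subtype_val
  -- the exact index `κ(D_v) = p^c ℤ_p`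
  obtain ⟨c, -, hc, hle⟩ := exists_pow_and_forall_dvd_of_not_le κ v hv
  -- moving an element of `H` to the right: `x h y ∈ x y H`
  have hmoveH : ∀ (x y h : absoluteGaloisGroup K), h ∈ H → ∃ h' ∈ H, x * h * y = x * y * h' :=
    fun x y h hh ↦ ⟨y⁻¹ * h * y, Subgroup.Normal.conj_mem' inferInstance h hh y, by group⟩
  -- the target: right-`H`-invariant, left-`D_v`-equivariant functions
  let P : AddSubgroup (absoluteGaloisGroup K → subgroupH1 (kerD κ v) (W.geomPrimaryTorsion p)) :=
    { carrier := {G | (∀ (σ h : absoluteGaloisGroup K), h ∈ H → G (σ * h) = G σ) ∧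
        ∀ (d : decomp (K := K) v) (σ : absoluteGaloisGroup K),
          G ((d : absoluteGaloisGroup K) * σ) = conjH1 (kerD κ v) (W.geomPrimaryTorsion p) d (G σ)}
      zero_mem' := ⟨fun _ _ _ ↦ rfl, fun d σ ↦ by simp only [Pi.zero_apply, map_zero]⟩
      add_mem' := fun {a b} ha hb ↦ ⟨fun σ h hh ↦ by simp only [Pi.add_apply, ha.1 σ h hh, hb.1 σ h hh],
        fun d σ ↦ by simp only [Pi.add_apply, ha.2 d σ, hb.2 d σ, map_add]⟩
      neg_mem' := fun {a} ha ↦ ⟨fun σ h hh ↦ by simp only [Pi.neg_apply, ha.1 σ h hh],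
        fun d σ ↦ by simp only [Pi.neg_apply, ha.2 d σ, map_neg]⟩ }
  -- a member of `P` evaluated at `d x h`
  have hPeval : ∀ G : P, ∀ (d : decomp (K := K) v) (x h : absoluteGaloisGroup K), h ∈ H →
      G.1 ((d : absoluteGaloisGroup K) * x * h) =
        conjH1 (kerD κ v) (W.geomPrimaryTorsion p) d (G.1 x) := by
    intro G d x h hh
    rw [mul_assoc, G.2.2 d, G.2.1 x h hh]
  -- the signature map `Φ : Sel^{Σ∪{v}} → P`
  have hΦmem : ∀ x : W.subgroupH1 p H,
      (fun σ ↦ resKerD κ (W.geomPrimaryTorsion p) v (W.conjH1 p H σ x)) ∈ P := by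
    intro x
    refine ⟨fun σ h hh ↦ ?_, fun d σ ↦ ?_⟩
    · simp only
      rw [W.conjH1_mul_holds p H, AddMonoidHom.comp_apply, W.conjH1_of_mem_holds p H hh,
        AddMonoidHom.id_apply]
    · simp only
      rw [W.conjH1_mul_holds p H, AddMonoidHom.comp_apply, resKerD_conjH1]
  let Φ : selmerAc W p κ 𝔭 (insert v S) →+ P :=
    { toFun := fun s ↦ ⟨fun σ ↦ resKerD κ (W.geomPrimaryTorsion p) v (W.conjH1 p H σ s), hΦmem s⟩
      map_zero' := Subtype.ext (funext fun σ ↦ by simp)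
      map_add' := fun a b ↦ Subtype.ext (funext fun σ ↦ by simp) }
  have hΦapply : ∀ (s : selmerAc W p κ 𝔭 (insert v S)) (σ : absoluteGaloisGroup K),
      (Φ s).1 σ = resKerD κ (W.geomPrimaryTorsion p) v (W.conjH1 p H σ s) := fun _ _ ↦ rfl
  -- `R_γ` on `P` and `ψ = R_γ - 1`
  have hRmem : ∀ G : P, (fun σ ↦ G.1 (σ * γ)) ∈ P := by
    intro G
    refine ⟨fun σ h hh ↦ ?_, fun d σ ↦ ?_⟩
    · simp only
      obtain ⟨h', hh', e⟩ := hmoveH σ γ h hh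
      rw [e, G.2.1 _ h' hh']
    · simp only
      rw [mul_assoc, G.2.2 d]
  let R : AddMonoid.End P :=
    { toFun := fun G ↦ ⟨fun σ ↦ G.1 (σ * γ), hRmem G⟩
      map_zero' := Subtype.ext (funext fun _ ↦ rfl)
      map_add' := fun _ _ ↦ Subtype.ext (funext fun _ ↦ rfl) }
  have hRapply : ∀ (G : P) (σ : absoluteGaloisGroup K), (R G).1 σ = G.1 (σ * γ) := fun _ _ ↦ rfl
  have hRpow : ∀ (n : ℕ) (G : P) (σ : absoluteGaloisGroup K), ((R ^ n) G).1 σ = G.1 (σ * γ ^ n) := by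
    intro n
    induction n with
    | zero => intro G σ; rw [pow_zero, pow_zero, mul_one, AddMonoid.End.one_apply]
    | succ n ih =>
      intro G σ
      rw [pow_succ, AddMonoid.End.coe_mul, Function.comp_apply, ih, hRapply, pow_succ, mul_assoc]
  obtain ⟨ψ, hψ⟩ : ∃ ψ : AddMonoid.End P, ψ = R - 1 := ⟨_, rfl⟩
  have hψapply : ∀ (G : P) (σ : absoluteGaloisGroup K), (ψ G).1 σ = G.1 (σ * γ) - G.1 σ :=
    fun _ _ ↦ by rw [hψ]; rfl
  -- (a) `φ = conj_γ - 1` is onto `Sel^{Σ∪{v}}`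
  have hφ := surjective_conjSelmerAc_sub_one_of_subsingleton W p κ hPT hEP h𝔭 h𝔮 hne hΓ𝔭 hfin h2 hγ
    (insert v S)
  -- the commutation `Φ ∘ φ = ψ ∘ Φ`
  have hcomm : ∀ s : selmerAc W p κ 𝔭 (insert v S),
      Φ ((conjSelmerAc W p κ 𝔭 (insert v S) γ - 1 : AddMonoid.End _) s) = ψ (Φ s) := by
    intro s
    apply Subtype.ext
    funext σ
    rw [hΦapply, hψapply, hΦapply, hΦapply, IwasawaDual.End_sub_apply, AddMonoid.End.one_apply,
      AddSubgroupClass.coe_sub, coe_conjSelmerAc_apply, map_sub, map_sub, W.conjH1_mul_holds p H,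
      AddMonoidHom.comp_apply]
  -- (c) `ψ` is locally nilpotent on `P`
  have hnil : ∀ G : P, ∃ N : ℕ, (ψ ^ N) G = 0 := by
    intro G
    -- one `t`, `k` for the finitely many values `G(γ^i)`, `i < p^c`
    obtain ⟨t, k, htk⟩ := exists_forall_dvd_imp_conjH1_kerD_eq_finset κ hM htor v hc
      ((Finset.range (p ^ c)).image fun i ↦ G.1 (γ ^ i))
    have hval : ∀ σ : absoluteGaloisGroup K, p ^ k • G.1 σ = 0 ∧ ∀ d' : decomp (K := K) v,
        (p : ℤ_[p]) ^ t ∣ (κ (d' : absoluteGaloisGroup K)).toAdd →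
        conjH1 (kerD κ v) (W.geomPrimaryTorsion p) d' (G.1 σ) = G.1 σ := by
      intro σ
      obtain ⟨d, n, h, hn, hh, rfl⟩ := exists_decomp_mul_pow_lt_mul_mem_ker κ hγ v hc σ
      have hmem : G.1 (γ ^ n) ∈ (Finset.range (p ^ c)).image fun i ↦ G.1 (γ ^ i) :=
        Finset.mem_image.mpr ⟨n, Finset.mem_range.mpr hn, rfl⟩
      obtain ⟨hk, ht⟩ := htk _ hmem
      rw [hPeval G d (γ ^ n) h hh]
      refine ⟨by rw [← map_nsmul, hk, map_zero], fun d' hd' ↦ ?_⟩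
      have e : d' * d = d * (d⁻¹ * d' * d) := by group
      have hκ' : (κ ((d⁻¹ * d' * d : decomp (K := K) v) : absoluteGaloisGroup K)).toAdd =
          (κ (d' : absoluteGaloisGroup K)).toAdd := by
        simp only [Subgroup.coe_mul, Subgroup.coe_inv, map_mul, map_inv, toAdd_mul, toAdd_inv]
        abel
      rw [← AddMonoidHom.comp_apply, ← conjH1_mul_holds (kerD κ v), e,
        conjH1_mul_holds (kerD κ v), AddMonoidHom.comp_apply, ht _ (by rw [hκ']; exact hd')]
    -- `γ^{p^{c+t}} = d_N h_N` with `p^t ∣ κ d_N`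
    obtain ⟨dN, hdN⟩ := hc ((p : ℤ_[p]) ^ t)
    have hhN : ((dN : absoluteGaloisGroup K))⁻¹ * γ ^ p ^ (c + t) ∈ H := by
      rw [hH, ZpExtension.mem_kerSubgroup, map_mul, map_inv, map_pow, hγ', ← ofAdd_nsmul]
      apply Multiplicative.toAdd.injective
      rw [toAdd_mul, toAdd_inv, toAdd_ofAdd, toAdd_one, hdN, nsmul_eq_mul, mul_one, Nat.cast_pow,
        pow_add, neg_add_cancel]
    have hRN : (R ^ p ^ (c + t)) G = G := by
      apply Subtype.ext
      funext σ
      rw [hRpow]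
      obtain ⟨d, n, h, -, hh, rfl⟩ := exists_decomp_mul_pow_lt_mul_mem_ker κ hγ v hc σ
      obtain ⟨h', hh', e1⟩ := hmoveH ((d : absoluteGaloisGroup K) * γ ^ n) (γ ^ p ^ (c + t)) h hh
      obtain ⟨h'', hh'', e3⟩ := hmoveH ((d : absoluteGaloisGroup K) * dN) (γ ^ n)
        (((dN : absoluteGaloisGroup K))⁻¹ * γ ^ p ^ (c + t)) hhN
      have e2 : (d : absoluteGaloisGroup K) * γ ^ n * γ ^ p ^ (c + t) * h' =
          (d : absoluteGaloisGroup K) * dN * (((dN : absoluteGaloisGroup K))⁻¹ * γ ^ p ^ (c + t)) *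
            γ ^ n * h' := by
        group
      rw [e1, e2, e3, mul_assoc _ h'' h', G.2.1 _ _ (H.mul_mem hh'' hh'), ← Subgroup.coe_mul,
        G.2.2 (d * dN) (γ ^ n), conjH1_mul_holds (kerD κ v), AddMonoidHom.comp_apply,
        (hval (γ ^ n)).2 dN ⟨(p : ℤ_[p]) ^ c, by rw [hdN, mul_comm]⟩, hPeval G d (γ ^ n) h hh]
    have hkG : p ^ k • G = 0 :=
      Subtype.ext (funext fun σ ↦ show p ^ k • G.1 σ = 0 from (hval σ).1)
    exact ⟨k * p ^ (c + t), hψ ▸ IwasawaDual.pow_mul_prime_pow_apply_eq_zero hpr R (c + t) hRN hkG⟩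
  -- (b) `ker ψ ⊆ im Φ`
  have hker : ∀ G : P, ψ G = 0 → G ∈ Φ.range := by
    intro G hG
    have hper : ∀ σ : absoluteGaloisGroup K, G.1 (σ * γ) = G.1 σ := fun σ ↦ by
      have h := congrArg (fun X : P ↦ X.1 σ) hG
      simp only [hψapply] at h
      exact sub_eq_zero.mp h
    obtain ⟨f, hf⟩ : ∃ f : subgroupH1 (kerD κ v) (W.geomPrimaryTorsion p), G.1 1 = f := ⟨_, rfl⟩
    -- `G(γ^n) = f`
    have hpow : ∀ n : ℕ, G.1 (γ ^ n) = f := by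
      intro n
      induction n with
      | zero => rw [pow_zero, hf]
      | succ n ih => rw [pow_succ, hper, ih]
    -- `f` is fixed by every `d ∈ D_v`
    obtain ⟨t, ht⟩ := exists_forall_dvd_imp_conjH1_kerD_eq κ hM v hc f
    have hfix : ∀ d : decomp (K := K) v, conjH1 (kerD κ v) (W.geomPrimaryTorsion p) d f = f := by
      intro d
      -- `κ d = p^c z`, `z = n + p^t w`: `d = d₂ · e` with `κ d₂ = p^c p^t w`, `κ e = p^c n`
      obtain ⟨z, hz⟩ := hle d
      obtain ⟨w, hw⟩ := Ideal.mem_span_singleton.mp (PadicInt.appr_spec t z)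
      obtain ⟨d₂, hd₂⟩ := hc ((p : ℤ_[p]) ^ t * w)
      have hκe : (κ ((d₂⁻¹ * d : decomp (K := K) v) : absoluteGaloisGroup K)).toAdd =
          (p : ℤ_[p]) ^ c * (z.appr t : ℕ) := by
        rw [Subgroup.coe_mul, Subgroup.coe_inv, map_mul, map_inv, toAdd_mul, toAdd_inv, hd₂, hz]
        linear_combination (p : ℤ_[p]) ^ c * hw
      have hh₀ : (((d₂⁻¹ * d : decomp (K := K) v) : absoluteGaloisGroup K))⁻¹ *
          γ ^ (p ^ c * z.appr t) ∈ H := by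
        rw [hH, ZpExtension.mem_kerSubgroup, map_mul, map_inv, map_pow, hγ', ← ofAdd_nsmul]
        apply Multiplicative.toAdd.injective
        rw [toAdd_mul, toAdd_inv, toAdd_ofAdd, toAdd_one, hκe, nsmul_eq_mul, mul_one, Nat.cast_mul,
          Nat.cast_pow, neg_add_cancel]
      have h1 : conjH1 (kerD κ v) (W.geomPrimaryTorsion p) (d₂⁻¹ * d) f = f := by
        have h := hpow (p ^ c * z.appr t)
        rw [show γ ^ (p ^ c * z.appr t) = ((d₂⁻¹ * d : decomp (K := K) v) : absoluteGaloisGroup K) *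
            1 * ((((d₂⁻¹ * d : decomp (K := K) v) : absoluteGaloisGroup K))⁻¹ *
              γ ^ (p ^ c * z.appr t)) by group, hPeval G _ 1 _ hh₀, hf] at h
        exact h
      have h2 : conjH1 (kerD κ v) (W.geomPrimaryTorsion p) d₂ f = f :=
        ht d₂ ⟨(p : ℤ_[p]) ^ c * w, by rw [hd₂]; ring⟩
      calc conjH1 (kerD κ v) (W.geomPrimaryTorsion p) d f
          = conjH1 (kerD κ v) (W.geomPrimaryTorsion p) (d₂ * (d₂⁻¹ * d)) f := by
            rw [mul_inv_cancel_left]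
        _ = f := by rw [conjH1_mul_holds (kerD κ v), AddMonoidHom.comp_apply, h1, h2]
    -- procyclic descent on `D_v`: `f = res z`
    obtain ⟨z, hz⟩ :=
      ProcyclicDescent.exists_resSubgroup_eq_of_forall_conjH1_eq hA (kappaD κ v) htor f hfix
    -- Poitou–Tate surgery at the base: the finite set `T` of places
    have hp0 : p ≠ 0 := hpr.ne_zero
    have hbadfin : (W.badPlaces (𝓞 K)).Finite := W.finite_badPlaces_holds (𝓞 K)
    let T : Finset (Place K) := (Finset.univ.image Sum.inl) ∪
      (((finite_setOf_natCast_mem (K := K) p hp0).toFinset ∪ hbadfin.toFinset ∪ {v}).image Sum.inr)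
    have hinf : ∀ w : InfinitePlace K, (Sum.inl w : Place K) ∈ T := fun w ↦
      Finset.mem_union_left _ (Finset.mem_image_of_mem _ (Finset.mem_univ w))
    have hpT : ∀ w : HeightOneSpectrum (𝓞 K), ((p : ℕ) : 𝓞 K) ∈ w.asIdeal →
        (Sum.inr w : Place K) ∈ T := fun w hw ↦
      Finset.mem_union_right _ (Finset.mem_image_of_mem _ (Finset.mem_union_left _
        (Finset.mem_union_left _ ((Set.Finite.mem_toFinset _).mpr hw))))
    have hbad : ∀ w : HeightOneSpectrum (𝓞 K), ¬ W.HasGoodReductionAt w →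
        (Sum.inr w : Place K) ∈ T := fun w hw ↦
      Finset.mem_union_right _ (Finset.mem_image_of_mem _ (Finset.mem_union_left _
        (Finset.mem_union_right _ ((Set.Finite.mem_toFinset _).mpr hw))))
    have hvT : (Sum.inr v : Place K) ∈ T :=
      Finset.mem_union_right _ (Finset.mem_image_of_mem _ (Finset.mem_union_right _
        (Finset.mem_singleton_self v)))
    have hSig : ∀ w ∈ ({v} : Set (HeightOneSpectrum (𝓞 K))), (Sum.inr w : Place K) ∈ T :=
      fun w hw ↦ by rw [Set.mem_singleton_iff.mp hw]; exact hvT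
    have hSp : ∀ w ∈ ({v} : Set (HeightOneSpectrum (𝓞 K))), ((p : ℕ) : 𝓞 K) ∉ w.asIdeal :=
      fun w hw ↦ by rw [Set.mem_singleton_iff.mp hw]; exact hpv
    have hRfin : {w : HeightOneSpectrum (𝓞 K) | (Sum.inr w : Place K) ∈ T ∧
        ((p : ℕ) : 𝓞 K) ∉ w.asIdeal}.Finite :=
      (T.finite_toSet.preimage Sum.inr_injective.injOn).subset fun w hw ↦ hw.1
    have hfinR := finite_relaxed W p (𝔮 := 𝔮) hEP hfin hRfin (fun w hw ↦ hw.2)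
    have hΓ := noInvariants_of_noInvariants_at W p hΓ𝔭
    have hv𝔭 : v ≠ 𝔭 := fun h ↦ hpv (h ▸ h𝔭)
    -- the local family: `infl z` at `v`, `0` at `𝔭`
    let zfam : ∀ w : HeightOneSpectrum (𝓞 K), subgroupH1 (decomp (K := K) w) (W.geomPrimaryTorsion p) :=
      fun w ↦ if h : w = v then
        cast (congrArg (fun x : HeightOneSpectrum (𝓞 K) ↦
          subgroupH1 (decomp (K := K) x) (W.geomPrimaryTorsion p)) h.symm) z else 0
    have hzv : zfam v = z := (dif_pos rfl).trans (cast_eq _ _)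
    let τ : ∀ w : (insert 𝔭 ({v} : Set (HeightOneSpectrum (𝓞 K))) : Set (HeightOneSpectrum (𝓞 K))),
        galoisCohomology
          ((primaryGaloisModule W p).toLocal (Sum.inr (w : HeightOneSpectrum (𝓞 K)))) 1 :=
      fun w ↦ inflDecomp hM (w : HeightOneSpectrum (𝓞 K)) (zfam w)
    have hτv : ∀ hv' : v ∈ insert 𝔭 ({v} : Set (HeightOneSpectrum (𝓞 K))),
        τ ⟨v, hv'⟩ = inflDecomp hM v z := fun hv' ↦ by
      change inflDecomp hM v (zfam v) = _
      rw [hzv]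
    have hτ0 : ∀ w : (insert 𝔭 ({v} : Set (HeightOneSpectrum (𝓞 K))) : Set (HeightOneSpectrum (𝓞 K))),
        (w : HeightOneSpectrum (𝓞 K)) ≠ v → τ w = 0 := fun w hw ↦ by
      change inflDecomp hM (w : HeightOneSpectrum (𝓞 K)) (zfam w) = 0
      rw [show zfam w = 0 from dif_neg hw, map_zero]
    obtain ⟨K₀, hK₀⟩ := exists_pow_nsmul_family_eq_zero ((Set.finite_singleton v).insert 𝔭) τ
    obtain ⟨N, xN, hxN, hloc⟩ := levelLiftingP_of_finite W p 𝔭 {v} T hPT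
      (fun w ↦ IsTotallyComplex.isComplex w) hΓ hΓ𝔭 h𝔭 h𝔮 hne hSp hinf hpT hSig hbad hfinR K₀ τ hK₀
    obtain ⟨s₀, hs₀⟩ : ∃ s₀ : W.subgroupH1 p H, s₀ = ResKernel.resSubgroup H (W.geomPrimaryTorsion p)
        (toDiscreteH1 hM (galoisCohomology.map (Levels.primaryInclusion W p N) 1 xN)) := ⟨_, rfl⟩
    have hconj : ∀ σ : absoluteGaloisGroup K, W.conjH1 p H σ s₀ = s₀ := fun σ ↦ by
      rw [hs₀]; exact conjH1_resSubgroup H σ _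
    -- the local values of `s₀`
    have hlv := hloc ⟨v, Set.mem_insert_of_mem _ rfl⟩
    rw [hτv] at hlv
    have hresv : resKerD κ (W.geomPrimaryTorsion p) v s₀ = f := by
      rw [hs₀, resKerD_resSubgroup, resSubgroup_decomp_eq_of_localization_eq hM v
        (galoisCohomology.map (Levels.primaryInclusion W p N) 1 xN) z hlv, hz]
    have hres0 : ∀ w : HeightOneSpectrum (𝓞 K), ((p : ℕ) : 𝓞 K) ∉ w.asIdeal → w ≠ v →
        resKerD κ (W.geomPrimaryTorsion p) w s₀ = 0 := by
      intro w hpw hwv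
      rw [hs₀, resKerD_resSubgroup, resSubgroup_decomp_eq_zero_of_localization_eq_zero hM w
        (galoisCohomology.map (Levels.primaryInclusion W p N) 1 xN)
        (localization_map_primaryInclusion_eq_zero_of_mem_upperStructureP W p N 𝔭 {v} hxN h𝔭 hpw
          (by simpa using hwv)), map_zero]
    have hl𝔭 := hloc ⟨𝔭, Set.mem_insert _ _⟩
    rw [hτ0 _ (Ne.symm hv𝔭)] at hl𝔭
    have hres𝔭 : resKerD κ (W.geomPrimaryTorsion p) 𝔭 s₀ = 0 := by
      rw [hs₀, resKerD_resSubgroup, resSubgroup_decomp_eq_zero_of_localization_eq_zero hM 𝔭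
        (galoisCohomology.map (Levels.primaryInclusion W p N) 1 xN) hl𝔭, map_zero]
    -- `s₀ ∈ Sel^{Σ∪{v}}`
    have hs₀Sel : s₀ ∈ selmerAc W p κ 𝔭 (insert v S) := by
      change s₀ ∈ selmerOver H (W.geomPrimaryTorsion p) p 𝔭 (insert v S)
      rw [mem_selmerOver_iff_awayKer]
      refine ⟨fun w hpw hwS σ ↦ ?_, fun w σ ↦ ?_, fun σ ↦ ?_⟩
      · rw [hconj, mem_awayKer_iff_resKerD_eq_zero]
        exact hres0 w hpw (fun h ↦ hwS (h ▸ Set.mem_insert v S))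
      · exact mem_infKer_of_decompInf_eq_bot w
          (decompInf_eq_bot_of_isComplex (IsTotallyComplex.isComplex w)) _
      · rw [hconj, mem_awayKer_iff_resKerD_eq_zero]
        exact hres𝔭
    refine ⟨⟨s₀, hs₀Sel⟩, Subtype.ext (funext fun σ ↦ ?_)⟩
    rw [hΦapply]
    change resKerD κ (W.geomPrimaryTorsion p) v (W.conjH1 p H σ s₀) = G.1 σ
    rw [hconj, hresv]
    obtain ⟨d, n, h, -, hh, rfl⟩ := exists_decomp_mul_pow_lt_mul_mem_ker κ hγ v hc σ
    rw [hPeval G d (γ ^ n) h hh, hpow, hfix]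
  -- the engine
  have hsurj := surjective_of_comm_of_surjective_of_ker_le Φ
    (conjSelmerAc W p κ 𝔭 (insert v S) γ - 1) ψ hcomm hφ hker hnil
  obtain ⟨s, hs⟩ := hsurj ⟨F, hFH, hFD⟩
  exact ⟨s, s.2, fun σ ↦ by rw [← hΦapply, hs]⟩

end Summit.BirchSwinnertonDyer.BirchSwinnertonDyer.Theorems.UniversalToricDescentSigmaLocalImage

end
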